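import Summits.AtomisticToContinuum.FouriersLaw.Theorems.JunctionLocalityNonBallisticDrudeLineDefs

/-!
# Line `drude-controls-conductance` (R1) of crux `NonBallistic` (stmt-AtomisticToContinuum-9127): the planner's cut implies the lead's cut

The planner's skeleton of `drude-controls-conductance` (crux-plan r1) cut the transferred crux `C⁺` into TWO statements over
finite-chain objects: `stub_fixedTimeLocality` (`N → ∞` FIRST at fixed time: `Var_eq,N(Φ_t)/N → v(t)`) and `stub_zeroDrudeWeight`
(THEN `liminf_t v(t)/t² = 0`, zero Drude weight of the infinite pinned chain in iterated-limit form). The lead's reshape R1 replaced the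
pair by the twin line's single windowed statement `SubballisticTransitWindow` (`transit-entropy-pairing`'s `stub_subballisticTransitWindow`
verbatim). This file records, kernel-checked, that the replacement LOSES NOTHING: the planner's pair implies the window statement (with
`a = 1` and a FIXED window `t(ε)` — the window never has to grow with `N`). So every engine aimed at `D(T) = 0` + fixed-time locality
(cards `drude-controls-conductance`, `static-duality-floor-ceiling`, `drude-coboundary-certificates`) feeds R1's only open stub unchanged.
The two hypotheses are spelled VERBATIM as the planner registered them (texts of `Registered.stub_fixedTimeLocality`,
`Registered.stub_zeroDrudeWeight` of the r1 skeleton); the conclusion is the Defs-file statement `DrudeLine.SubballisticTransitWindow`.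
-/

noncomputable section

namespace Summit.AtomisticToContinuum.FouriersLaw.Theorems.NonBallistic

open MeasureTheory Filter Topology
open scoped NNReal ENNReal BigOperators
open Literature.MathematicalPhysics.KineticTheory.HeatConduction
open Summit.AtomisticToContinuum.FouriersLaw.Theorems.NonBallistic.DrudeLine

/-- **The planner's cut implies the lead's cut.** Fixed-time locality (`Var_eq,N(Φ_t)/N → v(t)` for every `t > 0`) and zero
Drude weight in `liminf` form (`∀ ε ∃ t, v(t) ≤ εt²`) give the windowed sub-ballistic variance `SubballisticTransitWindow` with `a = 1`:
for `ε > 0` pick `t` with `v(t) ≤ (ε/2)t²`, then `N₁` with `Var_eq,N(Φ_t)/N < v(t) + (ε/2)t²` for `N ≥ N₁`; for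
`N ≥ max(N₁, ⌈t⌉)` the fixed window `τ = t` lies in `(0, 1·N]` and `Var_eq,N(Φ_t) ≤ ε N t²`. -/
theorem subballisticTransitWindow_of_fixedTimeLocality_of_zeroDrudeWeight :
    (∀ ω₂ lam β γ : ℝ, 0 < ω₂ → 0 < lam → 0 < β → 0 < γ → ∀ T : ℝ, 0 < T →
    ∀ C : ℕ → ℝ → ℝ,
      C = (fun (N : ℕ) (s : ℝ) => ∫ x, (∑ i : Fin N, (pinnedChain ω₂ lam β γ).bondCurrent N i x) *
            (∫ y, (∑ i : Fin N, (pinnedChain ω₂ lam β γ).bondCurrent N i y)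
              ∂((pinnedChain ω₂ lam β γ).transitionKernel N T T s.toNNReal x))
            ∂((pinnedChain ω₂ lam β γ).gibbsMeasure N T)) →
      ∃ v : ℝ → ℝ, ∀ t : ℝ, 0 < t →
        Tendsto (fun N : ℕ => (2 * ∫ s in (0 : ℝ)..t, (t - s) * C N s) / (N : ℝ)) atTop (𝓝 (v t))) →
    (∀ ω₂ lam β γ : ℝ, 0 < ω₂ → 0 < lam → 0 < β → 0 < γ → ∀ T : ℝ, 0 < T →
    ∀ C : ℕ → ℝ → ℝ,
      C = (fun (N : ℕ) (s : ℝ) => ∫ x, (∑ i : Fin N, (pinnedChain ω₂ lam β γ).bondCurrent N i x) *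
            (∫ y, (∑ i : Fin N, (pinnedChain ω₂ lam β γ).bondCurrent N i y)
              ∂((pinnedChain ω₂ lam β γ).transitionKernel N T T s.toNNReal x))
            ∂((pinnedChain ω₂ lam β γ).gibbsMeasure N T)) →
      ∀ v : ℝ → ℝ,
        (∀ t : ℝ, 0 < t →
          Tendsto (fun N : ℕ => (2 * ∫ s in (0 : ℝ)..t, (t - s) * C N s) / (N : ℝ)) atTop (𝓝 (v t))) →
        ∀ ε : ℝ, 0 < ε → ∃ t : ℝ, 0 < t ∧ v t ≤ ε * t ^ 2) →
    SubballisticTransitWindow := by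
  intro hL hZ ω₂ lam β γ hω hl hβ hγ T hT C hC
  obtain ⟨v, hv⟩ := hL ω₂ lam β γ hω hl hβ hγ T hT C hC
  have hZ' := hZ ω₂ lam β γ hω hl hβ hγ T hT C hC v hv
  refine ⟨1, one_pos, fun ε hε => ?_⟩
  -- one time with small per-site ballistic norm, then the thermodynamic limit at that time
  obtain ⟨t, ht, hvt⟩ := hZ' (ε / 2) (by positivity)
  have hgap : v t < v t + ε / 2 * t ^ 2 := by
    have : 0 < ε / 2 * t ^ 2 := by positivity
    linarith
  obtain ⟨N₁, hN₁⟩ := eventually_atTop.1 ((hv t ht).eventually_lt_const hgap)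
  obtain ⟨N₂, hN₂⟩ := exists_nat_ge t
  refine ⟨max N₁ N₂, fun N hN => ⟨t, ht, ?_, ?_⟩⟩
  · -- the fixed window fits: `t ≤ N₂ ≤ N = 1 · N`
    have h1 : (N₂ : ℝ) ≤ (N : ℝ) := by exact_mod_cast le_trans (le_max_right _ _) hN
    linarith
  · have hNpos : (0 : ℝ) < (N : ℝ) := by
      have h1 : (N₂ : ℝ) ≤ (N : ℝ) := by exact_mod_cast le_trans (le_max_right _ _) hN
      linarith
    have h1 : (2 * ∫ s in (0 : ℝ)..t, (t - s) * C N s) / (N : ℝ) < v t + ε / 2 * t ^ 2 :=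
      hN₁ N (le_trans (le_max_left _ _) hN)
    have h2 : (2 * ∫ s in (0 : ℝ)..t, (t - s) * C N s) < (v t + ε / 2 * t ^ 2) * (N : ℝ) :=
      (div_lt_iff₀ hNpos).1 h1
    have h3 : v t + ε / 2 * t ^ 2 ≤ ε * t ^ 2 := by linarith [hvt]
    have h4 : (v t + ε / 2 * t ^ 2) * (N : ℝ) ≤ ε * t ^ 2 * (N : ℝ) := mul_le_mul_of_nonneg_right h3 hNpos.le
    have h5 : ε * t ^ 2 * (N : ℝ) = ε * (N : ℝ) * t ^ 2 := by ring
    linarith [h2, h4, h5]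

end Summit.AtomisticToContinuum.FouriersLaw.Theorems.NonBallistic

end
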